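import Summits.Ventures.DiscreteObjects.Hadamard.PlainCyclesEven

/-!
# Signed cycles carrying a self-conjugate cyclotomic factor come in even numbers (kernel; master corollary)

Framing: lottery ticket; floor = certified bounds/negative ranges.

Cell pub-namedobj (venture DiscreteObjects), target (H), hadamard gen 15.  The general cycle reading of the even-multiplicity
theorem (`HadamardSignedAutParity`): let `H Hᵀ = n·1` with an odd prime `q ∣ n`, `q² ∤ n`, let `(π, κ, d, e)` be a signed
automorphism with `κ^M = 1`, `q ∤ M`, and let `m ∣ 2M` with `q^j ≡ -1 (mod m)` for some `j` ('`q` self-conjugate mod `m`';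
`m = 1, 2` always qualify).  A `κ`-cycle `C` of length `L` and sign product `ε = ∏_{j ∈ C} e j` CARRIES `Φ_m` when
`Φ_m ∣ X^L - ε`, i.e. (`CyclotomicFactorRoots`) when `ε = 1 ∧ m ∣ L` or `ε = -1 ∧ m ∣ 2L ∧ m ∤ L`.

**`hadamard_signedAut_cyclotomic_cycles_even`**: the number of `κ`-cycles carrying `Φ_m` is EVEN
(`2 ∣ Σ_{L ≤ M} #{j on such cycles of length L} / L`); dually for rows.  Instances: `m = 1` is `PlainCyclesEven`;
`m = 2`: the cycles with `ε = (-1)^L` (`hadamard_signedAut_alternating_cycles_even`); `m = 4` (`q ≡ 3 mod 4`): plain cycles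
with `4 ∣ L` together with nega cycles with `L ≡ 2 (mod 4)`; `m = 4p`: `Order2pNegaParity`.  At `668` (`q = 167`) the
admissible `m ≤ 44` (those with `−1 ∈ ⟨167 mod m⟩`) are `1,2,3,4,5,6,7,8,9,10,11,12,13,14,17,18,19,21,22,24,25,26,27,28,29,31,33,34,
36,37,38,41,42,44` (`hadamard668_signedAut_cyclotomic_cycles_even` takes the witness `j`).  Proof: an irreducible `h ∣ Φ_m` has even multiplicity; class by class (`cycleClass_count`, vanishing,
`finrank_ker_inf_supp_biUnion`) the multiplicity is `Σ #cycles carrying Φ_m`.  Ours; no `sorry`.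
-/

open Polynomial Finset BigOperators Matrix

namespace Summit.Ventures.DiscreteObjects.Hadamard

open Literature.Combinatorics.Designs.GoethalsSeidel (IsHadamardMatrix)

variable {ι : Type*} [Fintype ι] [DecidableEq ι]

/-- **Cycles carrying `Φ_m` come in even numbers (columns).**  See the module docstring. -/
theorem hadamard_signedAut_cyclotomic_cycles_even (H : Matrix ι ι ℤ) {n : ℤ} (hH : H * Hᵀ = n • (1 : Matrix ι ι ℤ))
    {q : ℕ} [Fact q.Prime] (hqn : (q : ℤ) ∣ n) (hq2 : ¬ (q : ℤ) ^ 2 ∣ n) (hqodd : q ≠ 2)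
    {π κ : Equiv.Perm ι} {d e : ι → ℤ} (hA : IsSignedAut H π κ d e)
    {M : ℕ} (hM : 0 < M) (hκM : ∀ j, (κ ^ M) j = j) (hqM : ((2 * M : ℕ) : ZMod q) ≠ 0)
    {m j₀ : ℕ} (hm : 0 < m) (hmM : m ∣ 2 * M) (hj : q ^ j₀ % m = m - 1) :
    2 ∣ ∑ L ∈ range (M + 1),
      (univ.filter (fun j => Function.minimalPeriod κ j = L ∧
        ((∏ i ∈ range L, e ((κ ^ i) j) = 1 ∧ m ∣ L) ∨
         (∏ i ∈ range L, e ((κ ^ i) j) = -1 ∧ m ∣ 2 * L ∧ ¬ m ∣ L)))).card / L := by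
  have he := hA.2.1
  have hq : q.Prime := Fact.out
  have h2F : (2 : ZMod q) ≠ 0 := by
    intro h0
    have : ((2 : ℕ) : ZMod q) = 0 := by exact_mod_cast h0
    rw [ZMod.natCast_eq_zero_iff] at this
    exact hqodd ((Nat.prime_dvd_prime_iff_eq hq Nat.prime_two).mp this)
  have h2MF : ∀ k : ℕ, k ∣ 2 * M → (k : ZMod q) ≠ 0 := by
    intro k hk h0
    apply hqM
    obtain ⟨c, hc⟩ := hk
    rw [hc]
    push_cast
    rw [h0, zero_mul]
  have hMF : (M : ZMod q) ≠ 0 := h2MF M ⟨2, by ring⟩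
  have hmF : (m : ZMod q) ≠ 0 := h2MF m hmM
  -- the pull-back and the main theorem with an irreducible factor h of Φ_m
  have hee : ∀ j, (fun j => ((e j : ℤ) : ZMod q)) j * (fun j => ((e j : ℤ) : ZMod q)) j = 1 :=
    signedAut_sign_sq hA q
  set Kt : Matrix ι ι (ZMod q) := Matrix.of fun j k => if k = κ j then ((e j : ℤ) : ZMod q) else 0 with hKt
  obtain ⟨h, hirr, hdvdΦ, hdvdX, hdeg⟩ := exists_irreducible_factor_cyclotomic (F := ZMod q) (m := m) hm
  have hmain := hadamard_signedAut_even_multiplicity H hH hqn hq2 hA Kt hKt hM hκM hqM hmM hj hirr hdvdX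
  -- the dividing conditions for h
  have hdvd1 : ∀ L, h ∣ X ^ L - C (1 : ZMod q) ↔ m ∣ L := fun L => by
    rw [C_1]; exact cyclotomic_factor_dvd_X_pow_sub_one_iff hmF hirr hdvdΦ L
  have hdvd2 : ∀ L, h ∣ X ^ L - C (-1 : ZMod q) ↔ m ∣ 2 * L ∧ ¬ m ∣ L := fun L => by
    rw [X_pow_sub_C_neg_one]; exact cyclotomic_factor_dvd_X_pow_add_one_iff hmF h2F hirr hdvdΦ L
  -- periods
  have hPM : ∀ j, Function.IsPeriodicPt κ M j := fun j => by
    rw [Function.IsPeriodicPt, Function.IsFixedPt, Equiv.Perm.iterate_eq_pow]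
    exact hκM j
  have hperiodic : ∀ j, j ∈ Function.periodicPts κ := fun j => Function.mem_periodicPts.mpr ⟨M, hM, hPM j⟩
  have hLpos : ∀ j, 0 < Function.minimalPeriod κ j := fun j => (hPM j).minimalPeriod_pos hM
  have hLle : ∀ j, Function.minimalPeriod κ j ≤ M := fun j => (hPM j).minimalPeriod_le hM
  have hLdvd : ∀ j, Function.minimalPeriod κ j ∣ M := fun j => (hPM j).minimalPeriod_dvd
  have hLfix : ∀ j, (κ ^ Function.minimalPeriod κ j) j = j := fun j => by
    have := Function.iterate_minimalPeriod (f := κ) (x := j)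
    rwa [Equiv.Perm.iterate_eq_pow] at this
  have hLmin : ∀ j t, 0 < t → t < Function.minimalPeriod κ j → (κ ^ t) j ≠ j := by
    intro j t ht0 ht hfix
    have hp : Function.IsPeriodicPt κ t j := by
      rw [Function.IsPeriodicPt, Function.IsFixedPt, Equiv.Perm.iterate_eq_pow]
      exact hfix
    exact absurd (hp.minimalPeriod_le ht0) (by omega)
  have hLκ : ∀ j, Function.minimalPeriod κ (κ j) = Function.minimalPeriod κ j := fun j =>
    Function.minimalPeriod_apply (hperiodic j)
  -- the classes of constant (length, sign)
  set S : ℕ × ℤ → Finset ι := fun c =>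
    univ.filter (fun j => Function.minimalPeriod κ j = c.1 ∧ ∏ i ∈ range c.1, e ((κ ^ i) j) = c.2) with hSdef
  have hmemS : ∀ c j, j ∈ S c ↔ Function.minimalPeriod κ j = c.1 ∧ ∏ i ∈ range c.1, e ((κ ^ i) j) = c.2 :=
    fun c j => by rw [hSdef]; simp only [mem_filter, mem_univ, true_and]
  set 𝓛 : Finset (ℕ × ℤ) := range (M + 1) ×ˢ ({1, -1} : Finset ℤ) with h𝓛
  have hSκ : ∀ c ∈ 𝓛, ∀ j, κ j ∈ S c ↔ j ∈ S c := by
    intro c _ j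
    rw [hmemS, hmemS, hLκ j]
    constructor
    · rintro ⟨hL, hs⟩
      refine ⟨hL, ?_⟩
      rw [← hs, ← hL, cycleSign_apply_int he (hLfix j)]
    · rintro ⟨hL, hs⟩
      refine ⟨hL, ?_⟩
      rw [← hs, ← hL, cycleSign_apply_int he (hLfix j)]
  have hdisj : ∀ c ∈ 𝓛, ∀ c' ∈ 𝓛, c ≠ c' → Disjoint (S c) (S c') := by
    intro c _ c' _ hcc'
    rw [Finset.disjoint_left]
    intro j hj hj'
    obtain ⟨h1, h2⟩ := (hmemS c j).mp hj
    obtain ⟨h1', h2'⟩ := (hmemS c' j).mp hj'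
    apply hcc'
    have e1 : c.1 = c'.1 := h1.symm.trans h1'
    refine Prod.ext e1 ?_
    rw [← h2, ← h2', e1]
  have hcover : 𝓛.biUnion S = univ := by
    apply Finset.eq_univ_of_forall
    intro j
    rw [Finset.mem_biUnion]
    refine ⟨(Function.minimalPeriod κ j, ∏ i ∈ range (Function.minimalPeriod κ j), e ((κ ^ i) j)), ?_,
      (hmemS _ j).mpr ⟨rfl, rfl⟩⟩
    rw [h𝓛, Finset.mem_product]
    refine ⟨mem_range.mpr (by have := hLle j; omega), ?_⟩
    rcases prod_range_pm' (fun t => he ((κ ^ t) j)) (Function.minimalPeriod κ j) with h1 | h1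
    · rw [h1]; simp
    · rw [h1]; simp
  -- the 'carries Φ_m' predicate on classes
  let good : ℕ × ℤ → Prop := fun c => (c.2 = 1 ∧ m ∣ c.1) ∨ (c.2 = -1 ∧ m ∣ 2 * c.1 ∧ ¬ m ∣ c.1)
  -- per-class dimensions
  have hclass : ∀ c ∈ 𝓛,
      Module.finrank (ZMod q) ↥(LinearMap.ker (aeval (Matrix.toLinAlgEquiv' Kt) h) ⊓
        Submodule.pi {j | j ∉ S c} (fun _ => (⊥ : Submodule (ZMod q) (ZMod q)))) =
        h.natDegree * (if good c then (S c).card / c.1 else 0) := by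
    intro c hc
    obtain ⟨L, ε⟩ := c
    have hε : ε = 1 ∨ ε = -1 := by
      rw [h𝓛, Finset.mem_product] at hc
      simpa using hc.2
    have hper : ∀ j ∈ S (L, ε), (κ ^ L) j = j := fun j hj => by
      have e1 := ((hmemS _ j).mp hj).1
      dsimp only at e1
      rw [← e1]
      exact hLfix j
    have hmin : ∀ j ∈ S (L, ε), ∀ t, 0 < t → t < L → (κ ^ t) j ≠ j := fun j hj t ht0 ht => by
      have e1 := ((hmemS _ j).mp hj).1
      dsimp only at e1
      apply hLmin j t ht0
      rw [e1]
      exact ht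
    have hsgn : ∀ j ∈ S (L, ε), ∏ i ∈ range L, (fun j => ((e j : ℤ) : ZMod q)) ((κ ^ i) j) = ((ε : ℤ) : ZMod q) :=
      fun j hj => by
        have e2 := ((hmemS _ j).mp hj).2
        dsimp only at e2
        rw [← e2, Int.cast_prod]
    -- empty classes contribute nothing
    by_cases hne : S (L, ε) = ∅
    · rw [hne, finrank_ker_inf_supp_empty, Finset.card_empty, Nat.zero_div]
      split_ifs <;> simp
    obtain ⟨j₀, hj₀⟩ := Finset.nonempty_iff_ne_empty.mpr hne
    have hLj₀ : Function.minimalPeriod κ j₀ = L := by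
      have e1 := ((hmemS _ j₀).mp hj₀).1
      exact e1
    have hLpos' : 0 < L := by rw [← hLj₀]; exact hLpos j₀
    have hLM : L ∣ M := by rw [← hLj₀]; exact hLdvd j₀
    have hLF : (L : ZMod q) ≠ 0 := h2MF L (dvd_trans hLM ⟨2, by ring⟩)
    -- the characteristic block X^L - C ε is separable
    have hεF : ((ε : ℤ) : ZMod q) ≠ 0 := by
      rcases hε with rfl | rfl
      · rw [Int.cast_one]; exact one_ne_zero
      · rw [Int.cast_neg, Int.cast_one]; exact neg_ne_zero.mpr one_ne_zero
    have hsep : (X ^ L - C ((ε : ℤ) : ZMod q) : (ZMod q)[X]).Separable := separable_X_pow_sub_C _ hLF hεF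
    -- does h divide the block?
    have hgood_iff : h ∣ X ^ L - C ((ε : ℤ) : ZMod q) ↔ good (L, ε) := by
      rcases hε with rfl | rfl
      · rw [Int.cast_one, hdvd1]
        show m ∣ L ↔ ((1 : ℤ) = 1 ∧ m ∣ L) ∨ ((1 : ℤ) = -1 ∧ m ∣ 2 * L ∧ ¬ m ∣ L)
        constructor
        · intro hd; exact Or.inl ⟨rfl, hd⟩
        · rintro (⟨-, hd⟩ | ⟨h1, -⟩)
          · exact hd
          · norm_num at h1
      · rw [Int.cast_neg, Int.cast_one, hdvd2]
        show (m ∣ 2 * L ∧ ¬ m ∣ L) ↔ ((-1 : ℤ) = 1 ∧ m ∣ L) ∨ ((-1 : ℤ) = -1 ∧ m ∣ 2 * L ∧ ¬ m ∣ L)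
        constructor
        · intro hd; exact Or.inr ⟨rfl, hd⟩
        · rintro (⟨h1, -⟩ | ⟨-, hd⟩)
          · norm_num at h1
          · exact hd
    by_cases hd : h ∣ X ^ L - C ((ε : ℤ) : ZMod q)
    · -- the class carries h: deg h dimensions per cycle
      obtain ⟨g, hg⟩ := hd
      have hcop : IsCoprime h g := by
        rw [hg] at hsep
        exact hsep.isCoprime
      have hcount := cycleClass_count κ (fun j => ((e j : ℤ) : ZMod q)) Kt hee hKt (S (L, ε)) (hSκ (L, ε) hc) hLpos'
        hper hmin hsgn hg.symm hcop
      obtain ⟨R, -, hcard, -⟩ := exists_cycle_reps κ (S (L, ε)) (hSκ (L, ε) hc) hLpos' hper hmin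
      rw [if_pos (hgood_iff.mp ⟨g, hg⟩)]
      dsimp only
      rw [hcard, Nat.mul_div_cancel_left _ hLpos']
      rw [hcard] at hcount
      apply Nat.eq_of_mul_eq_mul_left hLpos'
      rw [hcount]
      ring
    · -- the class does not carry h
      rw [if_neg (fun hg => hd (hgood_iff.mpr hg)), mul_zero]
      have h0 := ker_inf_supp_eq_bot_of_isCoprime κ (fun j => ((e j : ℤ) : ZMod q)) Kt hee hKt (h := h) (S (L, ε))
        (fun _ => L) hper (fun j hj => by rw [hsgn j hj]; exact (Irreducible.coprime_iff_not_dvd hirr).mpr hd)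
      rw [h0, finrank_bot]
  -- sum over the partition
  have hsplit := finrank_ker_inf_supp_biUnion κ (fun j => ((e j : ℤ) : ZMod q)) Kt hKt h 𝓛 S hSκ hdisj
  rw [hcover, ker_inf_supp_univ, Finset.sum_congr rfl hclass, ← Finset.mul_sum, h𝓛, Finset.sum_product] at hsplit
  -- identify the inner sums with the summands of the statement
  have hpair : ∀ L ∈ range (M + 1),
      ∑ ε ∈ ({1, -1} : Finset ℤ), (if good (L, ε) then (S (L, ε)).card / ((L, ε) : ℕ × ℤ).1 else 0) =
        (univ.filter (fun j => Function.minimalPeriod κ j = L ∧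
          ((∏ i ∈ range L, e ((κ ^ i) j) = 1 ∧ m ∣ L) ∨
           (∏ i ∈ range L, e ((κ ^ i) j) = -1 ∧ m ∣ 2 * L ∧ ¬ m ∣ L)))).card / L := by
    intro L _
    rw [Finset.sum_pair (by norm_num : (1 : ℤ) ≠ -1)]
    dsimp only
    by_cases h1 : m ∣ L
    · -- only the plain class can carry Φ_m
      have hg1 : good (L, 1) := Or.inl ⟨rfl, h1⟩
      have hg2 : ¬ good (L, -1) := by
        rintro (⟨h', -⟩ | ⟨-, -, h'⟩)
        · norm_num at h'
        · exact h' h1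
      rw [if_pos hg1, if_neg hg2, add_zero]
      congr 2
      ext j
      rw [hmemS]
      simp only [mem_filter, mem_univ, true_and]
      constructor
      · rintro ⟨hL, hs⟩; exact ⟨hL, Or.inl ⟨hs, h1⟩⟩
      · rintro ⟨hL, (⟨hs, -⟩ | ⟨-, -, h'⟩)⟩
        · exact ⟨hL, hs⟩
        · exact absurd h1 h'
    · by_cases h2 : m ∣ 2 * L
      · have hg1 : ¬ good (L, 1) := by
          rintro (⟨-, h'⟩ | ⟨h', -⟩)
          · exact h1 h'
          · norm_num at h'
        have hg2 : good (L, -1) := Or.inr ⟨rfl, h2, h1⟩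
        rw [if_neg hg1, if_pos hg2, zero_add]
        congr 2
        ext j
        rw [hmemS]
        simp only [mem_filter, mem_univ, true_and]
        constructor
        · rintro ⟨hL, hs⟩; exact ⟨hL, Or.inr ⟨hs, h2, h1⟩⟩
        · rintro ⟨hL, (⟨-, h'⟩ | ⟨hs, -, -⟩)⟩
          · exact absurd h' h1
          · exact ⟨hL, hs⟩
      · have hg1 : ¬ good (L, 1) := by
          rintro (⟨-, h'⟩ | ⟨h', -⟩)
          · exact h1 h'
          · norm_num at h'
        have hg2 : ¬ good (L, -1) := by
          rintro (⟨h', -⟩ | ⟨-, h', -⟩)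
          · norm_num at h'
          · exact h2 h'
        rw [if_neg hg1, if_neg hg2, add_zero]
        have hempty : (univ.filter (fun j => Function.minimalPeriod κ j = L ∧
            ((∏ i ∈ range L, e ((κ ^ i) j) = 1 ∧ m ∣ L) ∨
             (∏ i ∈ range L, e ((κ ^ i) j) = -1 ∧ m ∣ 2 * L ∧ ¬ m ∣ L)))) = ∅ := by
          rw [Finset.eq_empty_iff_forall_notMem]
          intro j hj
          rw [mem_filter] at hj
          rcases hj.2.2 with ⟨-, h'⟩ | ⟨-, h', -⟩
          · exact h1 h'
          · exact h2 h'
        rw [hempty, Finset.card_empty, Nat.zero_div]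
  rw [Finset.sum_congr rfl hpair] at hsplit
  rw [hsplit, mul_comm 2 h.natDegree] at hmain
  exact Nat.dvd_of_mul_dvd_mul_left hdeg hmain

/-- **`m = 2`: the cycles `C` with `∏_C e = (−1)^{|C|}` (even plain cycles and odd nega cycles) come in even numbers** —
every odd `q`, every signed automorphism with `κ^M = 1`, `q ∤ M`. -/
theorem hadamard_signedAut_alternating_cycles_even (H : Matrix ι ι ℤ) {n : ℤ} (hH : H * Hᵀ = n • (1 : Matrix ι ι ℤ))
    {q : ℕ} [Fact q.Prime] (hqn : (q : ℤ) ∣ n) (hq2 : ¬ (q : ℤ) ^ 2 ∣ n) (hqodd : q ≠ 2)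
    {π κ : Equiv.Perm ι} {d e : ι → ℤ} (hA : IsSignedAut H π κ d e)
    {M : ℕ} (hM : 0 < M) (hκM : ∀ j, (κ ^ M) j = j) (hqM : ((2 * M : ℕ) : ZMod q) ≠ 0) :
    2 ∣ ∑ L ∈ range (M + 1),
      (univ.filter (fun j => Function.minimalPeriod κ j = L ∧ ∏ i ∈ range L, e ((κ ^ i) j) = (-1) ^ L)).card / L := by
  have he := hA.2.1
  have hq : q.Prime := Fact.out
  have hj : q ^ 1 % 2 = 2 - 1 := by
    rw [pow_one]
    rcases hq.eq_two_or_odd with h | h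
    · exact absurd h hqodd
    · exact h
  have hmain := hadamard_signedAut_cyclotomic_cycles_even H hH hqn hq2 hqodd hA hM hκM hqM (m := 2) (j₀ := 1) (by norm_num)
    ⟨M, rfl⟩ hj
  have hsum : ∑ L ∈ range (M + 1),
      (univ.filter (fun j => Function.minimalPeriod κ j = L ∧
        ((∏ i ∈ range L, e ((κ ^ i) j) = 1 ∧ 2 ∣ L) ∨
         (∏ i ∈ range L, e ((κ ^ i) j) = -1 ∧ 2 ∣ 2 * L ∧ ¬ 2 ∣ L)))).card / L =
      ∑ L ∈ range (M + 1),
        (univ.filter (fun j => Function.minimalPeriod κ j = L ∧ ∏ i ∈ range L, e ((κ ^ i) j) = (-1) ^ L)).card / L := by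
    refine Finset.sum_congr rfl fun L _ => ?_
    congr 2
    apply Finset.filter_congr
    intro j _
    rcases Nat.even_or_odd L with hL | hL
    · rw [hL.neg_one_pow]
      have h2 : 2 ∣ L := even_iff_two_dvd.mp hL
      constructor
      · rintro ⟨hp, (⟨hs, -⟩ | ⟨-, -, hn⟩)⟩
        · exact ⟨hp, hs⟩
        · exact absurd h2 hn
      · rintro ⟨hp, hs⟩
        exact ⟨hp, Or.inl ⟨hs, h2⟩⟩
    · rw [hL.neg_one_pow]
      have h2 : ¬ 2 ∣ L := fun h => (Nat.not_even_iff_odd.mpr hL) (even_iff_two_dvd.mpr h)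
      constructor
      · rintro ⟨hp, (⟨-, hd⟩ | ⟨hs, -, -⟩)⟩
        · exact absurd hd h2
        · exact ⟨hp, hs⟩
      · rintro ⟨hp, hs⟩
        exact ⟨hp, Or.inr ⟨hs, ⟨L, by ring⟩, h2⟩⟩
  rw [hsum] at hmain
  exact hmain

/-- **Rows.** -/
theorem hadamard_signedAut_cyclotomic_cycles_even_row (H : Matrix ι ι ℤ) {n : ℤ}
    (hH : H * Hᵀ = n • (1 : Matrix ι ι ℤ)) {q : ℕ} [Fact q.Prime] (hqn : (q : ℤ) ∣ n) (hq2 : ¬ (q : ℤ) ^ 2 ∣ n)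
    (hqodd : q ≠ 2) {π κ : Equiv.Perm ι} {d e : ι → ℤ} (hA : IsSignedAut H π κ d e)
    {M : ℕ} (hM : 0 < M) (hπM : ∀ i, (π ^ M) i = i) (hqM : ((2 * M : ℕ) : ZMod q) ≠ 0)
    {m j₀ : ℕ} (hm : 0 < m) (hmM : m ∣ 2 * M) (hj : q ^ j₀ % m = m - 1) :
    2 ∣ ∑ L ∈ range (M + 1),
      (univ.filter (fun i => Function.minimalPeriod π i = L ∧
        ((∏ t ∈ range L, d ((π ^ t) i) = 1 ∧ m ∣ L) ∨
         (∏ t ∈ range L, d ((π ^ t) i) = -1 ∧ m ∣ 2 * L ∧ ¬ m ∣ L)))).card / L := by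
  have hn : n ≠ 0 := by
    rintro rfl
    exact hq2 (dvd_zero _)
  have hHt : Hᵀ * Hᵀᵀ = n • (1 : Matrix ι ι ℤ) := by
    rw [Matrix.transpose_transpose]
    exact transpose_mul_self_of_mul_transpose H n hn hH
  exact hadamard_signedAut_cyclotomic_cycles_even Hᵀ hHt hqn hq2 hqodd (isSignedAut_transpose hA) hM hπM hqM hm hmM hj

/-- **H(668)** (`q = 167`): for a signed automorphism with `κ^M = 1`, `167 ∤ M`, and `m ∣ 2M` with `167^j ≡ −1 (mod m)`, the
number of `κ`-cycles carrying `Φ_m` is even (columns; rows by the `_row` theorem).  E.g. `(m, j) = (3,1), (4,1), (5,2), (6,1),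
(7,1), (8,1), (9,3), (10,2), (11,5), (12,1), (13,6), (14,1), (18,3), (21,1), (22,5), (24,1), (25,10), (26,6), (28,1), (37,18),
(41,4), (42,1), (44,5), (49,7), (50,10)`. -/
theorem hadamard668_signedAut_cyclotomic_cycles_even {H : Matrix ι ι ℤ} (hH : IsHadamardMatrix H)
    (hι : Fintype.card ι = 668) {π κ : Equiv.Perm ι} {d e : ι → ℤ} (haut : IsSignedAut H π κ d e) {M : ℕ}
    (hM : 0 < M) (hκM : ∀ j, (κ ^ M) j = j) (h167 : ¬ 167 ∣ M) {m j₀ : ℕ} (hm : 0 < m) (hmM : m ∣ 2 * M)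
    (hj : 167 ^ j₀ % m = m - 1) :
    2 ∣ ∑ L ∈ range (M + 1),
      (univ.filter (fun j => Function.minimalPeriod κ j = L ∧
        ((∏ i ∈ range L, e ((κ ^ i) j) = 1 ∧ m ∣ L) ∨
         (∏ i ∈ range L, e ((κ ^ i) j) = -1 ∧ m ∣ 2 * L ∧ ¬ m ∣ L)))).card / L := by
  haveI : Fact (Nat.Prime 167) := ⟨by norm_num⟩
  have hH' : H * Hᵀ = (668 : ℤ) • (1 : Matrix ι ι ℤ) := by rw [hH.2, hι]; norm_num
  have hqM : ((2 * M : ℕ) : ZMod 167) ≠ 0 := by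
    rw [Ne, ZMod.natCast_eq_zero_iff]
    intro h
    rcases (Nat.Prime.dvd_mul (by norm_num : Nat.Prime 167)).mp h with h2 | h2
    · revert h2; norm_num
    · exact h167 h2
  exact hadamard_signedAut_cyclotomic_cycles_even H hH' (by norm_num) (by norm_num) (by norm_num) haut hM hκM hqM hm
    hmM hj

end Summit.Ventures.DiscreteObjects.Hadamard
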